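import Summits.AtomisticToContinuum.HydrodynamicLimit.Theses.StiffCollisionalRelaxation
import Summits.AtomisticToContinuum.HydrodynamicLimit.Theorems.AprioriBounds.Negative.AllLambda
import Summits.AtomisticToContinuum.HydrodynamicLimit.Theorems.LocalSecondLaw.Negative.HomogeneousLLN
import Summits.AtomisticToContinuum.HydrodynamicLimit.Theorems.DenseExcursion.Negative.Untied
import Literature.Analysis.FluidPDE.HardSphereAlexander
import Literature.Analysis.FluidPDE.HardSphereFlowRegular
import Literature.MathematicalPhysics.KineticTheory.HardSphereEulerProofs

/-!
# The critical exponential parameter of the pre-shock a-priori crux at equilibrium: `λ < 1/(2θ₀)`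

Negative-side support for the crux `StiffCollisionalRelaxation.AprioriBounds` (stmt-AtomisticToContinuum-14827,
rev 3; refuter-cdisprove-stmt-AtomisticToContinuum-14827-0, cycle 4; work file
`Cruxes/AprioriBounds/Disproof.lean` §9).  Quantitative form of the `∀ λ` refutation
(`Negative/AllLambda.lean`): along Alexander's regularised hard-sphere flows and the homogeneous local Gibbs
laws `(1, θ₀, 0)` (`0 < σ < 1/2`), component (i) of the crux FAILS for EVERY `λ ≥ 1/(2θ₀)`, every horizon
`t > 0` and every constant `C` (`equilibrium_partOne_fails_of_le_lambda`): the probability of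
`{C < ∫₀ᵗ (N+1)⁻¹∑ᵢ exp(λ|vᵢ(s)|²) ds}` does not tend to `0` — it tends to `1`, because the empirical
moment dominates the CRITICAL Maxwellian moment (`λ = 1/(2θ₀)`, infinite mean), whose time average exceeds
every constant with probability `→ 1` (flow-invariance of the homogeneous Gibbs law + Markov–Tonelli,
`measure_setIntegral_orbit_le`, `tendsto_localGibbsMeasure_expAvg_le`).  Consequences:
* `lambda_lt_of_equilibrium_partOne` (crux-free): every pair `(λ, C)` witnessing (i) along these flows at
  equilibrium data has `λ < 1/(2θ₀)`;
* `aprioriBounds_equilibrium_lambda_lt` (UNCONDITIONAL, uses the tree's identified `t = 0` LLN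
  `homogeneous_lln_identified` and the constant classical solution to discharge the rev-3 prefix): the
  crux's own existential `λ` at the data `(1, θ₀, 0)` is `< 1/(2θ₀)` — `λ` must be allowed to depend on the
  temperature range of the Euler solution (`λ · 2 sup θ < 1` is necessary), uniformly in nothing else.
No definitions; no Theses declaration is asserted.
-/

noncomputable section

open MeasureTheory Filter Set Topology
open scoped ENNReal

namespace Summit.AtomisticToContinuum.HydrodynamicLimit.Theorems.AprioriBoundsNegative

open Literature.MathematicalPhysics.KineticTheory Literature.Analysis.FluidPDE
open Summit.AtomisticToContinuum.HydrodynamicLimit.Theses.StiffCollisionalRelaxation (AprioriBounds)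

variable {N : ℕ}

/-- Along any configuration the empirical exponential moment at parameter `λ ≥ 0` is bounded by the
(conserved) energy: `(N+1)⁻¹ ∑ᵢ exp(λ|vᵢ|²) ≤ exp(λ · 2E(w))`. -/
theorem expAvg_le_exp_lam_energy {lam : ℝ} (hlam : 0 ≤ lam) (w : Config (N + 1) (Fin 3) T3) :
    ((N + 1 : ℕ) : ℝ)⁻¹ * ∑ i, Real.exp (lam * ‖(w i).2‖ ^ 2) ≤
      Real.exp (lam * (2 * configEnergy w)) := by
  have hterm : ∀ i, Real.exp (lam * ‖(w i).2‖ ^ 2) ≤ Real.exp (lam * (2 * configEnergy w)) := by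
    intro i
    refine Real.exp_le_exp.2 (mul_le_mul_of_nonneg_left ?_ hlam)
    unfold configEnergy
    rw [← mul_assoc, mul_inv_cancel₀ (two_ne_zero), one_mul]
    exact Finset.single_le_sum (f := fun j => ‖(w j).2‖ ^ 2) (fun j _ => by positivity)
      (Finset.mem_univ i)
  calc ((N + 1 : ℕ) : ℝ)⁻¹ * ∑ i, Real.exp (lam * ‖(w i).2‖ ^ 2)
      ≤ ((N + 1 : ℕ) : ℝ)⁻¹ * ∑ _i : Fin (N + 1), Real.exp (lam * (2 * configEnergy w)) :=
        mul_le_mul_of_nonneg_left (Finset.sum_le_sum fun i _ => hterm i) (by positivity)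
    _ = Real.exp (lam * (2 * configEnergy w)) := by
        rw [Finset.sum_const, Finset.card_univ, Fintype.card_fin, nsmul_eq_mul, ← mul_assoc,
          inv_mul_cancel₀ (by positivity), one_mul]

/-- The empirical moment is monotone in the parameter: at `λ ≥ 1/(2θ̄)` it dominates the critical one. -/
theorem criticalAvg_le_expAvg {θb lam : ℝ} (hlam : 1 / (2 * θb) ≤ lam)
    (w : Config (N + 1) (Fin 3) T3) :
    ((N + 1 : ℕ) : ℝ)⁻¹ * ∑ i, Real.exp (‖(w i).2‖ ^ 2 / (2 * θb)) ≤
      ((N + 1 : ℕ) : ℝ)⁻¹ * ∑ i, Real.exp (lam * ‖(w i).2‖ ^ 2) := by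
  refine mul_le_mul_of_nonneg_left (Finset.sum_le_sum fun i _ => Real.exp_le_exp.2 ?_) (by positivity)
  rw [div_eq_mul_inv, mul_comm, ← one_div]
  exact mul_le_mul_of_nonneg_right hlam (by positivity)

/-- **On the equilibrium rung, (i) fails for every `λ ≥ 1/(2θ₀)`.**  For `0 < σ < 1/2`, `θ₀ > 0`, along
Alexander's regularised hard-sphere flows and the homogeneous local Gibbs laws `(1, θ₀, 0)`: for every
`t > 0`, every `λ ≥ 1/(2θ₀)` and every `C`, `P_N{C < ∫₀ᵗ (N+1)⁻¹∑ᵢ exp(λ|vᵢ(s)|²) ds} ↛ 0`. -/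
theorem equilibrium_partOne_fails_of_le_lambda {σ θb : ℝ} (hσ : 0 < σ) (hσ2 : σ < 1 / 2)
    (hθ : 0 < θb) :
    ∃ Φ : (N : ℕ) → HardSphereFlow (Torus.geometry (Fin 3)) (hsDiameter σ N) (N + 1),
      ∀ t : ℝ, 0 < t → ∀ lam : ℝ, 1 / (2 * θb) ≤ lam → ∀ Cexp : ℝ,
        ¬ Tendsto (fun N : ℕ => localGibbsLaw σ (fun _ => 1) (fun _ => 0) (fun _ => θb) N (Φ N)
            {z | Cexp < ∫ s in Icc 0 t, ∫ y, Real.exp (lam * ‖y.2‖ ^ 2)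
              ∂(empiricalMeasure ((Φ N).flow s z))}) atTop (𝓝 0) := by
  set Φ : (N : ℕ) → HardSphereFlow (Torus.geometry (Fin 3)) (hsDiameter σ N) (N + 1) :=
    fun N => Alexander.regHardSphereFlow (d := Fin 3) (hsDiameter_pos hσ N)
      ((hsDiameter_le hσ.le N).trans_lt (by linarith)) (N + 1) with hΦ
  refine ⟨Φ, fun t ht lam hlam Cexp hT => ?_⟩
  have hlam0 : 0 ≤ lam := le_trans (by positivity) hlam
  -- the empirical moment at `λ` and the critical moment as phase-space functions
  set G : (N : ℕ) → Config (N + 1) (Fin 3) T3 → ℝ :=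
    fun N z => ((N + 1 : ℕ) : ℝ)⁻¹ * ∑ i, Real.exp (lam * ‖(z i).2‖ ^ 2) with hG
  set F : (N : ℕ) → Config (N + 1) (Fin 3) T3 → ℝ :=
    fun N z => ((N + 1 : ℕ) : ℝ)⁻¹ * ∑ i, Real.exp (‖(z i).2‖ ^ 2 / (2 * θb)) with hF
  have hGm : ∀ N, Measurable (G N) := fun N =>
    measurable_const.mul (Finset.measurable_sum _ fun i _ => by fun_prop)
  have hG0 : ∀ N z, 0 ≤ G N z := fun N z =>
    mul_nonneg (by positivity) (Finset.sum_nonneg fun i _ => (Real.exp_pos _).le)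
  set a : ℝ := 2 * (max Cexp 0 + 1) / t with ha
  have ha0 : 0 < a := by rw [ha]; positivity
  have hMa : Cexp ≤ a * t / 2 := by
    rw [ha]
    field_simp
    linarith [le_max_left Cexp 0]
  -- complement bound: Markov–Tonelli along the invariant law, then domination of the critical moment
  have hcompl : ∀ N, localGibbsLaw σ (fun _ => 1) (fun _ => 0) (fun _ => θb) N (Φ N)
      {z | ∫ s in Icc 0 t, ∫ y, Real.exp (lam * ‖y.2‖ ^ 2)
        ∂(empiricalMeasure ((Φ N).flow s z)) ≤ Cexp} ≤
      2 * localGibbsMeasure σ (fun _ => 1) (fun _ => 0) (fun _ => θb) N {z | F N z ≤ a} := by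
    intro N
    rw [localGibbsLaw_eq]
    haveI := isProbabilityMeasure_localGibbsMeasure (u₀ := fun _ => (0 : V3)) continuous_const
      continuous_const continuous_const (fun _ => one_pos) (fun _ => hθ) hσ2.le N
    have hev : {z : Config (N + 1) (Fin 3) T3 | ∫ s in Icc 0 t, ∫ y, Real.exp (lam * ‖y.2‖ ^ 2)
        ∂(empiricalMeasure ((Φ N).flow s z)) ≤ Cexp} =
        {z | ∫ s in Icc 0 t, G N ((Φ N).flow s z) ≤ Cexp} := by
      ext z
      simp only [mem_setOf_eq, hG, integral_empiricalMeasure]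
    rw [hev]
    have hflow : (Φ N).flow = Alexander.regFlow (Torus.geometry (Fin 3)) (hsDiameter σ N) := rfl
    have h1 : localGibbsMeasure σ (fun _ => 1) (fun _ => 0) (fun _ => θb) N
        {z | ∫ s in Icc 0 t, G N ((Φ N).flow s z) ≤ Cexp} ≤
        2 * localGibbsMeasure σ (fun _ => 1) (fun _ => 0) (fun _ => θb) N {z | G N z ≤ a} := by
      refine measure_setIntegral_orbit_le (localGibbsMeasure σ (fun _ => 1) (fun _ => 0) (fun _ => θb) N)
        (T := (Φ N).flow) ?_ ?_ (hGm N) (hG0 N) ?_ ht ha0 hMa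
      · rw [hflow]
        exact Alexander.measurable_regFlow_uncurry ((hsDiameter_le hσ.le N).trans_lt (by linarith))
      · intro s; rw [hflow]; exact measurePreserving_regFlow_localGibbsMeasure hσ hσ2 θb N s
      · intro z
        refine ⟨Real.exp (lam * (2 * configEnergy z)), fun s => ?_⟩
        rw [hflow]
        have := expAvg_le_exp_lam_energy (N := N) hlam0
          (Alexander.regFlow (Torus.geometry (Fin 3)) (hsDiameter σ N) s z)
        rwa [Alexander.configEnergy_regFlow] at this
    have h2 : localGibbsMeasure σ (fun _ => 1) (fun _ => 0) (fun _ => θb) N {z | G N z ≤ a} ≤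
        localGibbsMeasure σ (fun _ => 1) (fun _ => 0) (fun _ => θb) N {z | F N z ≤ a} :=
      measure_mono fun z hz => le_trans (criticalAvg_le_expAvg hlam z) hz
    exact h1.trans (by gcongr)
  -- both the event and its complement would have vanishing probability
  have htail : Tendsto (fun N : ℕ => 2 * localGibbsMeasure σ (fun _ => 1) (fun _ => 0) (fun _ => θb) N
      {z | F N z ≤ a}) atTop (𝓝 0) := by
    have h0 := tendsto_localGibbsMeasure_expAvg_le hσ2.le hθ a
    have := ENNReal.Tendsto.const_mul h0 (Or.inr (by norm_num : (2 : ℝ≥0∞) ≠ ⊤))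
    rw [mul_zero] at this
    exact this
  have hhalf : (0 : ℝ≥0∞) < 2⁻¹ := by norm_num
  have h1 := hT.eventually (gt_mem_nhds hhalf)
  have h2 := htail.eventually (gt_mem_nhds hhalf)
  obtain ⟨N, hN1, hN2⟩ := (h1.and h2).exists
  have huniv : localGibbsLaw σ (fun _ => 1) (fun _ => 0) (fun _ => θb) N (Φ N) univ = 1 := by
    haveI := isProbabilityMeasure_localGibbsLaw (u₀ := fun _ => (0 : V3)) continuous_const
      continuous_const continuous_const (fun _ => one_pos) (fun _ => hθ) hσ2.le N (Φ N)
    exact measure_univ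
  have hcover : (univ : Set (Config (N + 1) (Fin 3) T3)) ⊆
      {z | Cexp < ∫ s in Icc 0 t, ∫ y, Real.exp (lam * ‖y.2‖ ^ 2)
        ∂(empiricalMeasure ((Φ N).flow s z))} ∪
      {z | ∫ s in Icc 0 t, ∫ y, Real.exp (lam * ‖y.2‖ ^ 2)
        ∂(empiricalMeasure ((Φ N).flow s z)) ≤ Cexp} := by
    intro z _
    simp only [mem_union, mem_setOf_eq]
    exact lt_or_ge _ _
  have hsum := (measure_mono (μ := localGibbsLaw σ (fun _ => 1) (fun _ => 0) (fun _ => θb) N (Φ N))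
    hcover).trans (measure_union_le _ _)
  rw [huniv] at hsum
  have hlt : localGibbsLaw σ (fun _ => 1) (fun _ => 0) (fun _ => θb) N (Φ N)
      {z | Cexp < ∫ s in Icc 0 t, ∫ y, Real.exp (lam * ‖y.2‖ ^ 2)
        ∂(empiricalMeasure ((Φ N).flow s z))} +
      localGibbsLaw σ (fun _ => 1) (fun _ => 0) (fun _ => θb) N (Φ N)
      {z | ∫ s in Icc 0 t, ∫ y, Real.exp (lam * ‖y.2‖ ^ 2)
        ∂(empiricalMeasure ((Φ N).flow s z)) ≤ Cexp} < 2⁻¹ + 2⁻¹ :=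
    ENNReal.add_lt_add hN1 (lt_of_le_of_lt (hcompl N) hN2)
  rw [ENNReal.inv_two_add_inv_two] at hlt
  exact absurd (lt_of_le_of_lt hsum hlt) (lt_irrefl 1)

/-- **Every witness of (i) at equilibrium data is subcritical** (crux-free): for `0 < σ < 1/2` there is a
flow family (Alexander's) along which any `(λ, C)` with `λ > 0` that makes the bad event of (i) improbable,
at any horizon `t > 0`, has `λ < 1/(2θ₀)`. -/
theorem lambda_lt_of_equilibrium_partOne {σ θb : ℝ} (hσ : 0 < σ) (hσ2 : σ < 1 / 2) (hθ : 0 < θb) :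
    ∃ Φ : (N : ℕ) → HardSphereFlow (Torus.geometry (Fin 3)) (hsDiameter σ N) (N + 1),
      ∀ t : ℝ, 0 < t → ∀ lam Cexp : ℝ,
        Tendsto (fun N : ℕ => localGibbsLaw σ (fun _ => 1) (fun _ => 0) (fun _ => θb) N (Φ N)
            {z | Cexp < ∫ s in Icc 0 t, ∫ y, Real.exp (lam * ‖y.2‖ ^ 2)
              ∂(empiricalMeasure ((Φ N).flow s z))}) atTop (𝓝 0) →
        lam < 1 / (2 * θb) := by
  obtain ⟨Φ, hΦ⟩ := equilibrium_partOne_fails_of_le_lambda hσ hσ2 hθ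
  refine ⟨Φ, fun t ht lam Cexp hT => ?_⟩
  by_contra hle
  push Not at hle
  exact hΦ t ht lam hle Cexp hT

/-- **The crux's own `λ` at equilibrium data is subcritical** (UNCONDITIONAL).  At the profiles
`(1, θ₀, 0)` the rev-3 prefix is discharged for all small `σ` by the constant classical solution
`(1, 0, θ₀)` on `[0, t+1)` (`DenseExcursionUntied.isHardSphereEulerSolution_const`) and the identified
`t = 0` law of large numbers (`homogeneous_lln_identified`, every flow family); the chamber clause reads
`2σ³ < η₁`.  So for `σ` small, along Alexander's flows and for every `t > 0`, the crux PRODUCES a pair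
`(λ, C)` for (i), and by `lambda_lt_of_equilibrium_partOne` that `λ` is `< 1/(2θ₀)`: the exponential
parameter of any proof of the crux tends to `0` as the temperature of the data grows. -/
theorem aprioriBounds_equilibrium_lambda_lt (h : AprioriBounds) {θb : ℝ} (hθ : 0 < θb) :
    ∃ σ₀ : ℝ, 0 < σ₀ ∧ ∀ σ : ℝ, 0 < σ → σ < σ₀ →
      ∃ Φ : (N : ℕ) → HardSphereFlow (Torus.geometry (Fin 3)) (hsDiameter σ N) (N + 1),
        ∀ t : ℝ, 0 < t → ∃ lam Cexp : ℝ, 0 < lam ∧ lam < 1 / (2 * θb) ∧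
          Tendsto (fun N : ℕ => localGibbsLaw σ (fun _ => 1) (fun _ => 0) (fun _ => θb) N (Φ N)
            {z | Cexp < ∫ s in Icc 0 t, ∫ y, Real.exp (lam * ‖y.2‖ ^ 2)
              ∂(empiricalMeasure ((Φ N).flow s z))}) atTop (𝓝 0) := by
  obtain ⟨σc, hσc, η₁, hη₁, H⟩ := h (fun _ => 1) (fun _ => θb) (fun _ => 0) continuous_const
    continuous_const continuous_const (fun _ => one_pos) (fun _ => hθ)
  obtain ⟨σ₁, hσ₁, hσ₁2, hL⟩ := LocalSecondLawNegative.homogeneous_lln_identified hθ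
  refine ⟨min σc (min σ₁ (min 1 (η₁ / 2))),
    lt_min hσc (lt_min hσ₁ (lt_min one_pos (half_pos hη₁))), fun σ hσ hσlt => ?_⟩
  have hσc' : σ < σc := hσlt.trans_le (min_le_left _ _)
  have hσ₁' : σ < σ₁ := hσlt.trans_le ((min_le_right _ _).trans (min_le_left _ _))
  have hσ1 : σ < 1 := hσlt.trans_le ((min_le_right _ _).trans ((min_le_right _ _).trans (min_le_left _ _)))
  have hση : σ < η₁ / 2 :=
    hσlt.trans_le ((min_le_right _ _).trans ((min_le_right _ _).trans (min_le_right _ _)))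
  have hσhalf : σ < 1 / 2 := lt_of_lt_of_le hσ₁' hσ₁2
  have hσ3 : σ ^ 3 ≤ σ := pow_le_of_le_one hσ.le hσ1.le three_ne_zero
  obtain ⟨Φ, hΦ⟩ := lambda_lt_of_equilibrium_partOne hσ hσhalf hθ
  refine ⟨Φ, fun t ht => ?_⟩
  have hdil : ∀ s ∈ Icc 0 t, ∀ _x : T3, 2 * (fun (_ : ℝ) (_ : T3) => (1 : ℝ)) s _x * σ ^ 3 < η₁ := by
    intro s _ x
    show 2 * 1 * σ ^ 3 < η₁
    linarith
  obtain ⟨lam, Cexp, hlam, hT⟩ := (H σ hσ hσc' (t + 1) (fun _ _ => 1) (fun _ _ => θb) (fun _ _ => 0)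
    (DenseExcursionUntied.isHardSphereEulerSolution_const σ (t + 1) 0 one_pos hθ) Φ (hL σ hσ hσ₁' Φ)
    t ht (by linarith) hdil).1
  exact ⟨lam, Cexp, hlam, hΦ t ht lam Cexp hT, hT⟩

end Summit.AtomisticToContinuum.HydrodynamicLimit.Theorems.AprioriBoundsNegative

end
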